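import Summits.CriticalPhenomena.PercolationContinuityZ3.Theorems.PercNearOneGluingNoHeavyLowerTailFrontierDecRowsUnmarkedEdgeClone
import Summits.CriticalPhenomena.PercolationContinuityZ3.Theorems.PercNearOneGluingNoHeavyLowerTailGroupThreePointLBRows
import HarnessLib

/-!
# PATH (frontier row 36) and row 44 for ALL `n` and ALL markings, from their (terminal, unmarked) five-point edge forms alone

Support file (prover seat `prim-bnk-1`, gen 8; `--supports stmt-CriticalPhenomena-4575`).  No definitions, no named facts, no sorries, no `native_decide`.
Sequel of `…FrontierDecRowsUnmarkedEdgeClone` (`TerminalEdgeInduction.frontier_all_of_unmarkedEdgeHyp`: every frontier row at pairwise DISTINCT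
terminals from `UnmarkedEdgeHyp`).  Here the degenerate markings are discharged for the two headline open rows, so that the remaining
obligation is literally the five-point statement:
* `frontier_36_all_of_unmarkedEdgeHyp`: `(∀ m, UnmarkedEdgeHyp (row-36 families on Fin m)) → ∀ n w a b c y, 0 ≤ E₃(D[a|b], D[a|c], D[b|y])`
  — degenerate markings: an empty separation (`a = b`, `a = c`, `b = y`), the Harris cases `E₃(A,B,A)`, `E₃(A,A,C) ≥ 0` (`a = y`, `b = c`;
  `sahiE3_nonneg_of_repeat₁₃/₁₂`), and 3PT-LB `E₃(D[a|b],D[a|c],D[b|c]) ≥ 0` at `c = y` (`ThreePointLB.sahiE3_pairSep_nonneg`, prim-lit-2 / prim-cert-2).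
* `frontier_44_all_of_unmarkedEdgeHyp`: the same for `(D[ab|cy], D[a|b], D[c|y])`; every degenerate marking has an empty separation.
So PATH on every finite weighted graph (a NEW inductive route to 3PT-LB at `c = y`) ⟸ `B₁, B₂ ≥ 0` at the edge types (leaf, unmarked) and (hub, unmarked);
row 44 ⟸ `B₁, B₂ ≥ 0` at (terminal, unmarked) — cubic inequalities in the 52-cell law of five points (prim-l12-p1's polar5.py objects; census-true,
kit j092195; no certificate yet at degree ≤ 3).
-/

noncomputable section

namespace Summit.CriticalPhenomena.PercolationContinuityZ3.Theorems

namespace TerminalEdgeInduction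

open MeasureTheory Literature.Probability.Percolation Literature.Probability.LatticeModels
open EdgeInduction CovTransferCert E3GroupSepCert
open scoped Classical

variable {n : ℕ}
/-! ### Degenerate markings: empty separations and repeated events -/

/-- `E₃` vanishes when its first slot is a group separation with a vertex on both sides (the empty event). [folklore] -/
theorem sahiE3_sep_eq_zero_left {μ : Measure (BondConfig (Fin n))} {X Y : List (Fin n)} {v : Fin n} (hX : v ∈ X) (hY : v ∈ Y)
    (B C : Set (BondConfig (Fin n))) : sahiE3 μ (connEvent (sep X Y)) B C = 0 := by
  have he : connEvent (sep X Y) = ∅ := by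
    rw [connEvent_sep, Set.eq_empty_iff_forall_notMem]
    intro ω hω
    exact hω v hX v hY (SimpleGraph.Reachable.refl _)
  rw [he]; simp [sahiE3]

/-- `E₃` vanishes when its second slot is a group separation with a vertex on both sides. [folklore] -/
theorem sahiE3_sep_eq_zero_mid {μ : Measure (BondConfig (Fin n))} {X Y : List (Fin n)} {v : Fin n} (hX : v ∈ X) (hY : v ∈ Y)
    (A C : Set (BondConfig (Fin n))) : sahiE3 μ A (connEvent (sep X Y)) C = 0 := by
  have he : connEvent (sep X Y) = ∅ := by
    rw [connEvent_sep, Set.eq_empty_iff_forall_notMem]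
    intro ω hω
    exact hω v hX v hY (SimpleGraph.Reachable.refl _)
  rw [he]; simp [sahiE3]

/-- `E₃` vanishes when its third slot is a group separation with a vertex on both sides. [folklore] -/
theorem sahiE3_sep_eq_zero_right {μ : Measure (BondConfig (Fin n))} {X Y : List (Fin n)} {v : Fin n} (hX : v ∈ X) (hY : v ∈ Y)
    (A B : Set (BondConfig (Fin n))) : sahiE3 μ A B (connEvent (sep X Y)) = 0 := by
  have he : connEvent (sep X Y) = ∅ := by
    rw [connEvent_sep, Set.eq_empty_iff_forall_notMem]
    intro ω hω
    exact hω v hX v hY (SimpleGraph.Reachable.refl _)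
  rw [he]; simp [sahiE3]

/-- `E₃(A, B, A) = (1 − μA)(2μ(A∩B) − μA·μB) ≥ 0` for decreasing `A, B` (Harris). [folklore] -/
theorem sahiE3_nonneg_of_repeat₁₃ (w : Sym2 (Fin n) → unitInterval) {A B : Set (BondConfig (Fin n))} (hA : IsLowerSet A) (hB : IsLowerSet B) :
    0 ≤ sahiE3 (prodBernoulli w) A B A := by
  have hH := prodBernoulli_harris_lower w hA hB (Set.toFinite _).measurableSet (Set.toFinite _).measurableSet
  have ha1 : (prodBernoulli w).real A ≤ 1 := measureReal_le_one
  have hb0 : 0 ≤ (prodBernoulli w).real B := measureReal_nonneg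
  have hx0 : 0 ≤ (prodBernoulli w).real (A ∩ B) := measureReal_nonneg
  simp only [sahiE3]
  rw [show A ∩ B ∩ A = A ∩ B by rw [Set.inter_right_comm, Set.inter_self], show B ∩ A = A ∩ B from Set.inter_comm _ _, Set.inter_self]
  nlinarith [mul_nonneg (sub_nonneg.2 ha1) (show 0 ≤ 2 * (prodBernoulli w).real (A ∩ B) - (prodBernoulli w).real A * (prodBernoulli w).real B by linarith)]

/-- `E₃(A, A, C) = (1 − μA)(2μ(A∩C) − μA·μC) ≥ 0` for decreasing `A, C` (Harris). [folklore] -/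
theorem sahiE3_nonneg_of_repeat₁₂ (w : Sym2 (Fin n) → unitInterval) {A C : Set (BondConfig (Fin n))} (hA : IsLowerSet A) (hC : IsLowerSet C) :
    0 ≤ sahiE3 (prodBernoulli w) A A C := by
  have hH := prodBernoulli_harris_lower w hA hC (Set.toFinite _).measurableSet (Set.toFinite _).measurableSet
  have ha1 : (prodBernoulli w).real A ≤ 1 := measureReal_le_one
  have hc0 : 0 ≤ (prodBernoulli w).real C := measureReal_nonneg
  have hx0 : 0 ≤ (prodBernoulli w).real (A ∩ C) := measureReal_nonneg
  simp only [sahiE3]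
  rw [Set.inter_self]
  nlinarith [mul_nonneg (sub_nonneg.2 ha1) (show 0 ≤ 2 * (prodBernoulli w).real (A ∩ C) - (prodBernoulli w).real A * (prodBernoulli w).real C by linarith)]

/-! ### PATH (row 36) and row 44 for ALL `n` and ALL markings from the (terminal, unmarked) five-point forms -/

/-- **PATH for all `n` from its (terminal, unmarked) edge forms.**  If `UnmarkedEdgeHyp` holds for the PATH triple
`(D[a|b], D[a|c], D[b|y])` at every number of vertices, then `0 ≤ E₃(D[a|b], D[a|c], D[b|y])` for EVERY marking (degenerate markings: empty
separation, or `E₃(A,B,A)`, `E₃(A,A,C)` by Harris, or 3PT-LB `ThreePointLB.sahiE3_pairSep_nonneg` at `c = y`). [this work] -/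
theorem frontier_36_all_of_unmarkedEdgeHyp
    (h : ∀ m : ℕ, UnmarkedEdgeHyp (fun x : Fin 4 → Fin m => connEvent (FrontierDecRows.row 36 m (x 0, x 1, x 2, x 3)).1)
      (fun x => connEvent (FrontierDecRows.row 36 m (x 0, x 1, x 2, x 3)).2.1)
      (fun x => connEvent (FrontierDecRows.row 36 m (x 0, x 1, x 2, x 3)).2.2))
    (w : Sym2 (Fin n) → unitInterval) (a b c y : Fin n) :
    0 ≤ sahiE3 (prodBernoulli w) (connEvent (FrontierDecRows.row 36 n (a, b, c, y)).1)
      (connEvent (FrontierDecRows.row 36 n (a, b, c, y)).2.1) (connEvent (FrontierDecRows.row 36 n (a, b, c, y)).2.2) := by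
  have hr : FrontierDecRows.row 36 n (a, b, c, y) = (sep [a] [b], sep [a] [c], sep [b] [y]) := rfl
  rw [hr]
  dsimp only
  by_cases hab : a = b
  · subst hab; exact le_of_eq (sahiE3_sep_eq_zero_left (v := a) (by simp) (by simp) _ _).symm
  by_cases hac : a = c
  · subst hac; exact le_of_eq (sahiE3_sep_eq_zero_mid (v := a) (by simp) (by simp) _ _).symm
  by_cases hby : b = y
  · subst hby; exact le_of_eq (sahiE3_sep_eq_zero_right (v := b) (by simp) (by simp) _ _).symm
  by_cases hay : a = y
  · subst hay
    rw [connEvent_sep_comm [b] [a]]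
    exact sahiE3_nonneg_of_repeat₁₃ w (isLowerSet_connEvent_sep _ _) (isLowerSet_connEvent_sep _ _)
  by_cases hbc : b = c
  · subst hbc
    exact sahiE3_nonneg_of_repeat₁₂ w (isLowerSet_connEvent_sep _ _) (isLowerSet_connEvent_sep _ _)
  by_cases hcy : c = y
  · subst hcy
    rw [connEvent_sep_one_one, connEvent_sep_one_one, connEvent_sep_one_one]
    exact ThreePointLB.sahiE3_pairSep_nonneg w a b c
  exact frontier_all_of_unmarkedEdgeHyp 36 h w a b c y hab hac hay hbc hby hcy

/-- **Row 44 for all `n` from its (terminal, unmarked) edge forms.**  If `UnmarkedEdgeHyp` holds for the triple `(D[ab|cy], D[a|b], D[c|y])`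
at every number of vertices, then `0 ≤ E₃(D[ab|cy], D[a|b], D[c|y])` for EVERY marking (all degenerate markings have an empty separation).
[this work] -/
theorem frontier_44_all_of_unmarkedEdgeHyp
    (h : ∀ m : ℕ, UnmarkedEdgeHyp (fun x : Fin 4 → Fin m => connEvent (FrontierDecRows.row 44 m (x 0, x 1, x 2, x 3)).1)
      (fun x => connEvent (FrontierDecRows.row 44 m (x 0, x 1, x 2, x 3)).2.1)
      (fun x => connEvent (FrontierDecRows.row 44 m (x 0, x 1, x 2, x 3)).2.2))
    (w : Sym2 (Fin n) → unitInterval) (a b c y : Fin n) :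
    0 ≤ sahiE3 (prodBernoulli w) (connEvent (FrontierDecRows.row 44 n (a, b, c, y)).1)
      (connEvent (FrontierDecRows.row 44 n (a, b, c, y)).2.1) (connEvent (FrontierDecRows.row 44 n (a, b, c, y)).2.2) := by
  have hr : FrontierDecRows.row 44 n (a, b, c, y) = (sep [a, b] [c, y], sep [a] [b], sep [c] [y]) := rfl
  rw [hr]
  dsimp only
  by_cases hab : a = b
  · subst hab; exact le_of_eq (sahiE3_sep_eq_zero_mid (v := a) (by simp) (by simp) _ _).symm
  by_cases hcy : c = y
  · subst hcy; exact le_of_eq (sahiE3_sep_eq_zero_right (v := c) (by simp) (by simp) _ _).symm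
  by_cases hac : a = c
  · subst hac; exact le_of_eq (sahiE3_sep_eq_zero_left (v := a) (by simp) (by simp) _ _).symm
  by_cases hay : a = y
  · subst hay; exact le_of_eq (sahiE3_sep_eq_zero_left (v := a) (by simp) (by simp) _ _).symm
  by_cases hbc : b = c
  · subst hbc; exact le_of_eq (sahiE3_sep_eq_zero_left (v := b) (by simp) (by simp) _ _).symm
  by_cases hby : b = y
  · subst hby; exact le_of_eq (sahiE3_sep_eq_zero_left (v := b) (by simp) (by simp) _ _).symm
  exact frontier_all_of_unmarkedEdgeHyp 44 h w a b c y hab hac hay hbc hby hcy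

end TerminalEdgeInduction

end Summit.CriticalPhenomena.PercolationContinuityZ3.Theorems
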